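import Mathlib
import HarnessLib
import Literature.AlgebraicGeometry.Resolution.ResolutionOfCurves
import Literature.AlgebraicGeometry.Resolution.ArithmeticalThreefolds
import Summits.ResolutionOfSingularities.ResolutionOfSingularities.Theses.WildQuotients

/-!
# Low-dimensional slices of `WildQuotientResolution` (crux stmt-ResolutionOfSingularities-15640, line `Sketch`)

Support for the skeleton `Cruxes/WildQuotientResolution/Lines/Sketch.lean` (v5) of the crux
`WildQuotients.WildQuotientResolution` (every Galois-type quotient `X₁` of a REGULAR integral `X′`
by a finite group in characteristic `p` has a resolution; open from dimension `4`). The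
dimension-bounded glued split `GluedSplitDim.wildQuotientResolution_dimLE_of_phaseZero_of_pClosedWQ d`
(p140132) reduces `WQ_{dim X₁ ≤ d}` to `PhaseZeroModel_{≤ d} ∧ PClosedWQ_{≤ d}`; this file records
where the bounded crux is ALREADY a theorem of the tree, so that no seat is spent below the honest
frontier:

* `wq_hasResolution_of_dim_le_one` — **`dim X₁ ≤ 1`, UNCONDITIONAL**: a reduced curve over any
  field is resolved by its normalisation (`hasResolution_of_dim_le_one`, Hartshorne V Rem. 3.8.1,
  proved in tree with `NoetherFiniteIntegralClosure_holds`); the quotient structure is not used.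
* `wq_hasResolution_of_dim_le_two` — **`dim X₁ ≤ 2` modulo the named fact
  `CossartJannsenSaito2020`** (resolution of excellent surfaces, Lipman 1978 / CJS 2020, vendored
  as `ResolutionOverUpToDim k 2` for every field; undischarged in tree).
* The `dim ≤ 3` slice modulo `CossartPiltant2019` is `Negative.wq_hasResolution_of_dim_le_three`
  (`Theorems/WildQuotientResolution/Negative/CounterexampleShape.lean`).

Consequently the first dimension in which any stub of the line has content not already in the
tree is `dim X₁ = dim X′ = 2` for UNCONDITIONAL statements (Phase 0 on surfaces: point blow-ups of
the finitely many closed points with non-p-closed inertia terminate — valuation-theoretic argument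
in `Lines/Sketch.md`, cycle 4) and `dim 4` for the crux itself.
-/

-- single-problem summit: the doubled namespace component `ResolutionOfSingularities` is forced
set_option linter.dupNamespace false

noncomputable section

open CategoryTheory AlgebraicGeometry TopologicalSpace
open Literature.AlgebraicGeometry.Resolution

namespace Summit.ResolutionOfSingularities.ResolutionOfSingularities.Theorems.WildQuotientResolution.LowDimension

/-- **The `dim X₁ ≤ 1` slice of the crux holds unconditionally**: an integral scheme of finite
type over a field with `dim ≤ 1` has a resolution (its normalisation; separatedness and the cover
`X′ → X₁` are not used). [cite: Hartshorne1977, Ch. V Rem. 3.8.1] -/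
theorem wq_hasResolution_of_dim_le_one {k : Type} [Field k] (X₁ : Scheme.{0})
    (f : X₁ ⟶ Spec (.of k)) [LocallyOfFiniteType f] [QuasiCompact f] [IsIntegral X₁]
    (hdim : topologicalKrullDim X₁ ≤ 1) : Scheme.HasResolution X₁ :=
  hasResolution_of_dim_le_one X₁ f hdim

/-- **The crux restricted to `dim X₁ ≤ 1`, in the binder format of the route decl**
(`WildQuotientResolution` with the extra hypothesis `topologicalKrullDim X₁ ≤ 1` — the shape the
bounded glue `GluedSplitDim` consumes as `hWQp` at `d = 1`), unconditionally. [folklore] -/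
theorem wildQuotientResolution_dim_le_one :
    ∀ (p : ℕ) (_ : p.Prime) (k : Type) [Field k] [CharP k p] (X' X₁ : Scheme.{0})
      (f : X₁ ⟶ Spec (.of k)) (q : X' ⟶ X₁) (G : Type) [Group G] [Finite G] (ρ : G →* Aut X'),
      IsSeparated f → LocallyOfFiniteType f → QuasiCompact f → IsIntegral X₁ → IsIntegral X' →
      Scheme.IsRegular X' → IsFinite q → Function.Surjective q.base →
      (∃ U : X₁.Opens, Dense (U : Set X₁) ∧ Etale (q ∣_ U)) → (∀ g : G, (ρ g).hom ≫ q = q) →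
      (∀ x y : X', q.base x = q.base y → ∃ g : G, (ρ g).hom.base x = y) →
      topologicalKrullDim X₁ ≤ 1 → Scheme.HasResolution X₁ := by
  intro p _ k _ _ X' X₁ f q G _ _ ρ _ hft hqc hX₁ _ _ _ _ _ _ _ hdim
  exact wq_hasResolution_of_dim_le_one X₁ f hdim

/-- **The `dim X₁ ≤ 2` slice of the crux holds modulo `CossartJannsenSaito2020`** (resolution of
reduced separated surfaces of finite type over every field — Lipman 1978; Cossart–Jannsen–Saito
2020, Thm. 1.2 — vendored as the named fact `CossartJannsenSaito2020`): again the quotient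
structure is not used. [cite: CossartJannsenSaito2020, Thm. 1.2] -/
theorem wq_hasResolution_of_dim_le_two (hCJS : CossartJannsenSaito2020.{0}) {k : Type} [Field k]
    (X₁ : Scheme.{0}) (f : X₁ ⟶ Spec (.of k)) [IsSeparated f] [LocallyOfFiniteType f]
    [QuasiCompact f] [IsIntegral X₁] (hdim : topologicalKrullDim X₁ ≤ 2) :
    Scheme.HasResolution X₁ :=
  hCJS k X₁ f ‹_› ‹_› ‹_› inferInstance (by exact_mod_cast hdim)

/-- **The crux restricted to `dim X₁ ≤ 2`, in the binder format of the route decl**, modulo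
`CossartJannsenSaito2020`. [cite: CossartJannsenSaito2020, Thm. 1.2] -/
theorem wildQuotientResolution_dim_le_two (hCJS : CossartJannsenSaito2020.{0}) :
    ∀ (p : ℕ) (_ : p.Prime) (k : Type) [Field k] [CharP k p] (X' X₁ : Scheme.{0})
      (f : X₁ ⟶ Spec (.of k)) (q : X' ⟶ X₁) (G : Type) [Group G] [Finite G] (ρ : G →* Aut X'),
      IsSeparated f → LocallyOfFiniteType f → QuasiCompact f → IsIntegral X₁ → IsIntegral X' →
      Scheme.IsRegular X' → IsFinite q → Function.Surjective q.base →
      (∃ U : X₁.Opens, Dense (U : Set X₁) ∧ Etale (q ∣_ U)) → (∀ g : G, (ρ g).hom ≫ q = q) →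
      (∀ x y : X', q.base x = q.base y → ∃ g : G, (ρ g).hom.base x = y) →
      topologicalKrullDim X₁ ≤ 2 → Scheme.HasResolution X₁ := by
  intro p _ k _ _ X' X₁ f q G _ _ ρ hsep hft hqc hX₁ _ _ _ _ _ _ _ hdim
  exact wq_hasResolution_of_dim_le_two hCJS X₁ f hdim

end Summit.ResolutionOfSingularities.ResolutionOfSingularities.Theorems.WildQuotientResolution.LowDimension

end
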